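import Summits.QuantumFields.YangMills.Theorems.BalabanUVNodesPortS1JacKStepDefs
import Summits.QuantumFields.YangMills.Theorems.BalabanUVNodesPortS1JacTorusRows

/-!
# NODE O port PT-A — GLUING THE TWO HALVES OF `JacRowsAB` (director-ym №522 (2) boundary): `JacKStep F → JacRowsABDom F → JacRowsAB F`, by the EXACT `SL(2,ℂ)`-gauge invariance of the torus
# Jacobian functional `J_T(c, ·)` (✓ `…JacTorusRows.jacTorus_cAct`) and the linearity of the action (1.10) on pairs (route-independent; the crux composition from the four reshaped stubs is
# appended to the theses-cone file `…JacGlue`: `sig27930v8LR4_of_dom_kstep`)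

Cell `ym-nodeO-ideate`, porter seat `ymgap-nodeO-port-PTA-1` (gen 6); proof file, `--supports stmt-QuantumFields-27930`.  [I] = [Balaban1987RG1].
CONTENTS (theorems only).
* `analyticAt_cAct` — the action `φ ↦ φ^u` of a units-valued gauge transformation on `Sect2.CPair` is ℂ-analytic everywhere (it is ℂ-linear: bondwise `u₋ · φ.1 · u₊⁻¹`, `u₋ · φ.2 · u₋⁻¹`).
* ★★★ `jacRowsAB_of_kstep_of_dom : JacKStep F → JacRowsABDom F → JacRowsAB F` — take the loop threshold `a` of the complex-domain rows, the radii of the `k`-step reading at `a`; at a pair `φ` of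
  the record space gauge-fix by the reading's `det = 1` transformation `u`, apply the rows at `φ^u`, and pull back along `ψ ↦ ψ^u` (analytic) using `J_T(c, (ψ^u).1) = J_T(c, ψ.1)` for EVERY `ψ`.
* `jacRowsAB_all_of_kstep_of_dom` — the global form (the shape the skeleton composes; the crux composition `sig27930v8LR4_of_dom_kstep` lives in `…JacGlue`, which imports the route file).

HONEST FRAMING.  Bookkeeping over the porter's own definitions and theorems; NOTHING of Bałaban asserted or proved; the two halves `JacRowsABDom` (M, calculus over landed theorems) and `JacKStep`
(L, the complex small-field road of [12] Props. 1–2 ∕ [15] Prop. 9 — NOT in the tree) are OPEN; `stub_LZdet` BLOCKED-ON P0 (α)+(β); `stub_FE` XXL; 27930 OPEN · no claim; K0⁷∕K-Ax OPEN; NODE O 0∕1;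
COUNT 8∕28 · K 1∕4 UNMOVED; finite `𝕋⁴_{L^K}` at fixed ε — NOT continuum ∕ OS ∕ Clay; **the Yang–Mills mass gap is NOT proved by any of this.**  No `sorry`, no `def`, no `instance`, no `notation`;
standard axioms.
-/

noncomputable section

open scoped BigOperators Matrix.Norms.L2Operator Topology

namespace Summit.QuantumFields.YangMills.Theorems.BalabanUVNodesPortS1

open Summit.QuantumFields.YangMills.Theorems.K0RecordFormatNames
open Literature.MathematicalPhysics.QuantumFieldTheory.Balaban1983to89
open Literature.MathematicalPhysics.QuantumFieldTheory.Balaban1983to89.Node00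
open Literature.MathematicalPhysics.QuantumFieldTheory.Balaban1983to89.T4Continuum (T4Family)

/-! ## §1  The action (1.10) on pairs is analytic -/

/-- **The gauge action `φ ↦ φ^u` on `Sect2.CPair` is ℂ-analytic at every pair** (bondwise `u₋ φ.1 u₊⁻¹`, `u₋ φ.2 u₋⁻¹`: constants times a coordinate projection).
[cite: Balaban1987RG1, (1.10) p.262 (bookkeeping)] -/
theorem analyticAt_cAct {P : Params} (u : Site P 0 → (MatA 2)ˣ) (ψ : Sect2.CPair P (MatA 2)) : AnalyticAt ℂ (Sect2.cAct u) ψ := by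
  have h1 : ∀ b : PBond P 0, AnalyticAt ℂ (fun φ : Sect2.CPair P (MatA 2) => φ.1 b) ψ := fun b =>
    ((ContinuousLinearMap.proj (R := ℂ) (φ := fun _ : PBond P 0 => MatA 2) b).comp (ContinuousLinearMap.fst ℂ _ _)).analyticAt ψ
  have h2 : ∀ b : PBond P 0, AnalyticAt ℂ (fun φ : Sect2.CPair P (MatA 2) => φ.2 b) ψ := fun b =>
    ((ContinuousLinearMap.proj (R := ℂ) (φ := fun _ : PBond P 0 => MatA 2) b).comp (ContinuousLinearMap.snd ℂ _ _)).analyticAt ψ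
  show AnalyticAt ℂ (fun φ : Sect2.CPair P (MatA 2) =>
    ((fun b : PBond P 0 => ((u b.src : (MatA 2)ˣ) : MatA 2) * φ.1 b * (((u b.tgt)⁻¹ : (MatA 2)ˣ) : MatA 2)),
      (fun b : PBond P 0 => ((u b.src : (MatA 2)ˣ) : MatA 2) * φ.2 b * (((u b.src)⁻¹ : (MatA 2)ˣ) : MatA 2)))) ψ
  refine AnalyticAt.prod ?_ ?_
  · exact analyticAt_pi_iff.2 fun b => (analyticAt_const.mul (h1 b)).mul analyticAt_const
  · exact analyticAt_pi_iff.2 fun b => (analyticAt_const.mul (h2 b)).mul analyticAt_const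

/-! ## §2  ★★★ `JacKStep F → JacRowsABDom F → JacRowsAB F` -/

/-- ★★★ **THE TWO HALVES GIVE THE ROWS**: the `k`-step reading of (1.11)–(1.16) (a `det = 1` gauge transform of every record pair is tower-loop-small) and the complex-domain rows (analyticity and
the uniform bound at tower-loop-small fields) give `JacRowsAB F` — by the exact gauge invariance `J_T(c, (ψ^u).1) = J_T(c, ψ.1)` and the analyticity of `ψ ↦ ψ^u`.
[cite: Balaban1987RG1, p.263 L8–10, (1.18)–(1.19) p.263, p.267–268] -/
theorem jacRowsAB_of_kstep_of_dom (F : T4Family) (h1 : JacKStep F) (h2 : JacRowsABDom F) : JacRowsAB F := by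
  obtain ⟨a, E, ha, hE, hdom⟩ := h2
  obtain ⟨Mth, hM⟩ := h1 a ha
  refine ⟨Mth, fun Mc hMth hMcG => ?_⟩
  obtain ⟨α₀, α₁, hα₀, hα₁, hstep⟩ := hM Mc hMth hMcG
  refine ⟨α₀, α₁, E, hα₀, hα₁, hE, fun k n c φ hφ => ?_⟩
  obtain ⟨u, hu, hT⟩ := hstep k n c φ hφ
  have hk : k + 1 ≤ (F.P (recordK₀ F Mc k + n)).m + (F.P (recordK₀ F Mc k + n)).K := by
    rw [F.P_K]; unfold recordK₀; omega
  obtain ⟨hA, hB⟩ := hdom k _ hk c (Sect2.cAct u φ) hT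
  have hinv : ∀ ψ : Sect2.CPair (F.P (recordK₀ F Mc k + n)) (MatA 2), jacTorus k c (Sect2.cAct u ψ).1 = jacTorus k c ψ.1 :=
    fun ψ => jacTorus_cAct hk u hu ψ c
  refine ⟨?_, ?_⟩
  · have hcomp : AnalyticAt ℂ ((fun ψ : Sect2.CPair (F.P (recordK₀ F Mc k + n)) (MatA 2) => jacTorus k c ψ.1) ∘ Sect2.cAct u) φ :=
      AnalyticAt.comp hA (analyticAt_cAct u φ)
    have heq : ((fun ψ : Sect2.CPair (F.P (recordK₀ F Mc k + n)) (MatA 2) => jacTorus k c ψ.1) ∘ Sect2.cAct u) =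
        fun ψ : Sect2.CPair (F.P (recordK₀ F Mc k + n)) (MatA 2) => jacTorus k c ψ.1 := by
      funext ψ
      exact hinv ψ
    rw [heq] at hcomp
    exact hcomp
  · rw [← hinv φ]
    exact hB

/-- The global form: both halves for every torus family give `JacRowsAB` for every torus family. [cite: Balaban1987RG1, (1.18) p.263] -/
theorem jacRowsAB_all_of_kstep_of_dom (h1 : ∀ F : T4Family, JacKStep F) (h2 : ∀ F : T4Family, JacRowsABDom F) : ∀ F : T4Family, JacRowsAB F :=
  fun F => jacRowsAB_of_kstep_of_dom F (h1 F) (h2 F)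

end Summit.QuantumFields.YangMills.Theorems.BalabanUVNodesPortS1

end
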